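import Summits.BirchSwinnertonDyer.BirchSwinnertonDyer.Theorems.ThetaPartnerAtTwoSignedMainConjectureCMTwoRankZeroFlatTwistHecke
import Summits.BirchSwinnertonDyer.BirchSwinnertonDyer.Theorems.ThetaPartnerAtTwoSignedMainConjectureCMTwoRankZeroFlatLevelSixteen
import Literature.NumberTheory.EllipticCurves.PAdicLFunctionQuadraticTwistBirchPeriodProofs
import Literature.NumberTheory.EllipticCurves.Pal2012.QuadraticTwistPeriodProofs
import HarnessLib

/-!
# Route `ThetaPartnerAtTwo`, crux K2r0P `SignedMainConjectureCMTwoRankZeroOfPub` (stmt-BirchSwinnertonDyer-24945),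
# line `rankzero` v14, stub (μ♭)_A: ELEMENTARY TWIST TRANSPORT OF FLAT AT `p = 2`, part 1 — the plus-symbol congruence
# (C) between a habitat curve and its REAL PRIME QUADRATIC TWIST is a THEOREM (Birch + Pal + the period unit at `2`)

Cell `bsd-wall`, width seat `bsd-wall-tp2-p2-w3` (g2) on the lead line `rankzero` (skeleton v14 68851f95fafc3a88; after director
(159)(b) the crux K2R0P♭ 26471 takes FLAT as the hypothesis `AnalyticMuFlatCMTwoRankZero` and 24945 is its derived node, so
every FLAT certificate AT a class is a case of that hypothesis). THEOREMS ONLY (no `def`, no named fact, no `sorry`); helper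
`--supports` the crux; nothing about any particular curve is asserted; BSD is not proved by any of this. Sequel:
`…RankZeroFlatTwistAnchors` (transport of the residual certificate both ways, FLAT at the twist, anchors from print).

## The mechanism (no multiplicity one, no Ihara lemma, no (G′)_N)

Let `W/ℚ` be globally minimal, good at `2` with `2 ∣ a₂(W)`, `d > 0` a PRIME, `d ≡ 1 (mod 4)`, `(d, N_W) = 1`, and `A` a globally
minimal model of the quadratic twist `W^{(d)}` (`C • W.quadraticTwist d = A`), with newforms `f_W`, `f_A`. Birch's lemma with its
period constant (tree: `exists_ratPlusSymbol_twist_eq_sum_and_sq`, Mazur–Tate–Teitelbaum §I.8 / Shimura 3.64, bsd-2adic cell) says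
`[x]⁺_{f_A} = c·∑_{b mod d} (b/d)·[x + b/d]⁺_{f_W}` with `c²·d·(Ω⁺_{f_A})² = (Ω⁺_{f_W})²`. Three observations make this a MOD-2
statement about the doubled plus symbols `I(y) = 2([y]⁺ − [0]⁺) ∈ ℤ`:
1. `(b/d) ≡ 𝟙_{b ≠ 0} (mod 2)`, so the twisted sum is `≡` the plain sum over `b ≠ 0`, which the Hecke relation at `d`
   evaluates: `∑_b (b/d)(2[x+b/d] − 2[b/d]) ≡ I(x) + a_d·I(dx) + I(d²x) (mod 2)` (`FlatTwist.exists_int_twistedSum_eq`, p614468);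
2. `|c|₂ = 1`: Pal 2012 (`√d·Ω(A) = Ω(W)`, tree theorem) and the period unit at `2` for `W` and `A` (`h2`, a printed input of the
   crux: `Ω = u·Ω⁺_f`, `|u|₂ = 1`) turn the squared period identity into `(c·u_W)² = u_A²`;
3. hence `2([x]⁺_{f_A} − [0]⁺_{f_A}) ≡ I_W(x) + a_d I_W(dx) + I_W(d²x) (mod 2)` at every `x = b/4^k` — EXACTLY the plus-symbol
   congruence (C) that rtt-p4-w2's old-class descent `SignedMuAtTwo.exists_odd_of_plusSymbol_congruence` takes as hypothesis, with
   the dilation set `S = {1, d²}` (`a_d` even) or `{1, d, d²}` (`a_d` odd).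

* §1 bookkeeping (`even_sub_of_norm_intCast_eq`, `exists_sub_eq_two_mul_of_eq_unit_mul`, `norm_birchConst_eq_one`).
* §2 **`exists_plusSymbol_congruence_twist`** — the congruence (C) for `(f_A, f_W, S)` as a THEOREM (given some `[x]⁺_{f_A} ≠ 0`).

Scope (honest): `d` prime and positive. Composite square-free `d` needs the CRT recursion of the Hecke sum; `d < 0` reads the
plus symbols of `f_A` on the MINUS symbols of `f_W` (`CuspFormTwistRatPlusSymbolOdd`). Neither is done here.

References: B. Mazur, J. Tate, J. Teitelbaum, Invent. Math. 84 (1986) §I.4 (4.2), §I.8 [MazurTateTeitelbaum1986Invent]; V. Pal,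
Proc. AMS 140 (2012) Thm. 3.2 [Pal2012]; G. Shimura, *Introduction to the arithmetic theory of automorphic functions* (1971)
Prop. 3.64 [Shimura1971]; M. Emerton, R. Pollack, T. Weston, Invent. Math. 163 (2006) Lemma 4.4.4 [EmertonPollackWeston2006];
K. Ireland, M. Rosen, GTM 84, Prop. 5.2.2 [IrelandRosen1990].
-/

set_option autoImplicit false
-- the Theorems namespace of this sub repeats the summit name by design (D-0017 nested layout)
set_option linter.dupNamespace false

noncomputable section

open scoped Classical MatrixGroups ModularForm

namespace Summit.BirchSwinnertonDyer.BirchSwinnertonDyer.Theorems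

open scoped NumberField NumberTheorySymbols

open NumberField IsDedekindDomain Rat.HeightOneSpectrum CongruenceSubgroup
  Literature.NumberTheory.EllipticCurves Literature.NumberTheory.GaloisRepresentations
  WeierstrassCurve Literature.NumberTheory.EllipticCurves.ModularForms Literature.NumberTheory.EllipticCurves.Rank1Residual
  Literature.NumberTheory.EllipticCurves.Rank1Residual.Typed
  Summit.BirchSwinnertonDyer.Rank1Residual Summit.BirchSwinnertonDyer.Rank1Residual.Supersingular

namespace FlatTwist

/-! ## §1. `2`-adic bookkeeping: parity through `ℚ₂`-norms; the period constant is a `2`-adic unit -/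

section Bookkeeping

/-- Two integers with the same `2`-adic norm have the same parity. [folklore] -/
theorem even_sub_of_norm_intCast_eq {M J : ℤ} (h : ‖(M : ℚ_[2])‖ = ‖(J : ℚ_[2])‖) : Even (M - J) := by
  rw [Int.even_sub, even_iff_two_dvd, even_iff_two_dvd]
  have hM := Padic.norm_intCast_lt_one_iff (p := 2) (k := M)
  have hJ := Padic.norm_intCast_lt_one_iff (p := 2) (k := J)
  push_cast at hM hJ
  rw [← hM, ← hJ, h]

/-- `M = c·J` in `ℚ` with `|c|₂ = 1` (integers `M`, `J`) ⟹ `M ≡ J (mod 2)`. [folklore] -/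
theorem exists_sub_eq_two_mul_of_eq_unit_mul {M J : ℤ} {c : ℚ} (hc : ‖(c : ℚ_[2])‖ = 1) (h : (M : ℚ) = c * J) :
    ∃ z : ℤ, M - J = 2 * z := by
  have hnorm : ‖(M : ℚ_[2])‖ = ‖(J : ℚ_[2])‖ := by
    have h' : ((M : ℚ) : ℚ_[2]) = ((c * J : ℚ) : ℚ_[2]) := by rw [h]
    push_cast at h'
    rw [h', norm_mul, hc, one_mul]
  obtain ⟨z, hz⟩ := even_sub_of_norm_intCast_eq hnorm
  exact ⟨z, by rw [hz]; ring⟩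

/-- **The Birch constant is a `2`-adic unit.** If `c²·d·(Ω⁺_A)² = (Ω⁺_W)²` (Birch's lemma squared), the Néron periods read
`Ω(W) = u_W·Ω⁺_W`, `Ω(A) = u_A·Ω⁺_A` with `|u_W|₂ = |u_A|₂ = 1` (the period unit at `2`), `√d·Ω(A) = Ω(W)` (Pal 2012,
`d > 0`) and `Ω(A) > 0`, then `|c|₂ = 1`. [cite: Pal2012, Thm. 3.2 (case d > 0)] [cite: MazurTateTeitelbaum1986Invent, §I.8] -/
theorem norm_birchConst_eq_one {c uW uA : ℚ} {d : ℤ} (hd : 0 < d) {ΩW ΩA PW PA : ℝ} (hΩA : 0 < ΩA)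
    (hper : (c : ℝ) ^ 2 * (d : ℝ) * PA ^ 2 = PW ^ 2) (hW : ΩW = (uW : ℝ) * PW) (hA : ΩA = (uA : ℝ) * PA)
    (hPal : Real.sqrt (d : ℝ) * ΩA = ΩW) (huW : ‖(uW : ℚ_[2])‖ = 1) (huA : ‖(uA : ℚ_[2])‖ = 1) :
    ‖(c : ℚ_[2])‖ = 1 := by
  have hdR : (0 : ℝ) < d := by exact_mod_cast hd
  have huA0 : (uA : ℝ) ≠ 0 := by
    have h : uA ≠ 0 := by rintro rfl; simp at huA
    exact_mod_cast h
  have huW0 : (uW : ℝ) ≠ 0 := by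
    have h : uW ≠ 0 := by rintro rfl; simp at huW
    exact_mod_cast h
  have hPA : PA = ΩA / uA := by rw [hA]; field_simp
  have hPW : PW = ΩW / uW := by rw [hW]; field_simp
  have hΩW2 : ΩW ^ 2 = (d : ℝ) * ΩA ^ 2 := by rw [← hPal, mul_pow, Real.sq_sqrt hdR.le]
  -- `c²·d·Ω_A²/u_A² = d·Ω_A²/u_W²`
  have hsq : ((c * uW : ℚ) : ℝ) ^ 2 = ((uA : ℚ) : ℝ) ^ 2 := by
    rw [hPA, hPW, div_pow, div_pow, hΩW2] at hper
    have hne : (d : ℝ) * ΩA ^ 2 ≠ 0 := by positivity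
    push_cast
    field_simp at hper
    nlinarith [hper, hne, sq_nonneg ΩA]
  have hsqQ : (c * uW) ^ 2 = uA ^ 2 := by exact_mod_cast hsq
  have hn : ‖((c * uW : ℚ) : ℚ_[2])‖ ^ 2 = ‖((uA : ℚ) : ℚ_[2])‖ ^ 2 := by
    rw [← norm_pow, ← norm_pow]
    congr 1
    exact_mod_cast congrArg (fun q : ℚ ↦ ((q : ℚ) : ℚ_[2])) hsqQ
  push_cast at hn
  rw [norm_mul, huW, huA, mul_one] at hn
  nlinarith [hn, norm_nonneg ((c : ℚ) : ℚ_[2])]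

end Bookkeeping

/-! ## §2. The plus-symbol congruence (C) between a habitat curve and its real prime twist -/

section Congruence

variable (W : WeierstrassCurve ℚ) [W.IsElliptic] [W.IsGloballyMinimal] {d : ℤ} {A : WeierstrassCurve ℚ}
  [A.IsElliptic] [A.IsGloballyMinimal] [NeZero (W.conductorNorm ℤ)] [NeZero (A.conductorNorm ℤ)]
  {fW : CuspForm (Gamma0 (W.conductorNorm ℤ)) 2} {fA : CuspForm (Gamma0 (A.conductorNorm ℤ)) 2}

omit [W.IsElliptic] [W.IsGloballyMinimal] [A.IsElliptic] [A.IsGloballyMinimal] [NeZero (W.conductorNorm ℤ)]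
  [NeZero (A.conductorNorm ℤ)] in
/-- A prime `|d|` coprime to `N_W` does not divide `N_W`, and `W` has good reduction there. [folklore] -/
theorem not_natAbs_dvd_conductorNorm (hp : d.natAbs.Prime) (hcop : IsCoprime d (W.conductorNorm ℤ : ℤ)) :
    ¬ d.natAbs ∣ W.conductorNorm ℤ := by
  intro h
  have h1 : (d.natAbs : ℤ) ∣ d := Int.natAbs_dvd.mpr dvd_rfl
  have h2 : (d.natAbs : ℤ) ∣ (W.conductorNorm ℤ : ℤ) := Int.natCast_dvd_natCast.mpr h
  have hu := Int.isUnit_iff_natAbs_eq.mp (hcop.isUnit_of_dvd' h1 h2)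
  rw [Int.natAbs_natCast] at hu
  exact hp.one_lt.ne' hu

omit [A.IsElliptic] [A.IsGloballyMinimal] [NeZero (W.conductorNorm ℤ)] [NeZero (A.conductorNorm ℤ)] in
/-- The Legendre weight `b ↦ (b/ℓ)` on `ℤ/ℓ` (`ℓ` prime) is `≡ 𝟙_{b ≠ 0} (mod 2)`: `(0/ℓ) = 0`, `(b/ℓ) = ±1` otherwise.
[cite: IrelandRosen1990, Prop. 5.2.2] -/
theorem exists_jacobiWeight_eq_indicator_add {m : ℕ} [NeZero m] (hp : m.Prime) {χ : MulChar (ZMod m) ℤ}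
    (hχ : ∀ a : ZMod m, χ a = J((a.val : ℤ) | m)) (b : ZMod m) :
    ∃ t : ℤ, χ b = (if b = 0 then 0 else 1) + 2 * t := by
  rw [hχ]
  by_cases hb : b = 0
  · subst hb
    refine ⟨0, ?_⟩
    rw [ZMod.val_zero, Nat.cast_zero, jacobiSym.zero_left hp.one_lt]
    simp
  · rw [if_neg hb]
    haveI : Fact m.Prime := ⟨hp⟩
    have hval : b.val ≠ 0 := fun h ↦ hb ((ZMod.val_eq_zero b).mp h)
    have hlt : b.val < m := ZMod.val_lt b
    have hcop : (b.val : ℤ).gcd m = 1 := by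
      rw [Int.gcd_natCast_natCast]
      exact (Nat.coprime_of_lt_prime hval hlt hp).symm
    rcases jacobiSym.eq_one_or_neg_one hcop with h | h
    · exact ⟨0, by rw [h]; ring⟩
    · exact ⟨-1, by rw [h]; ring⟩

/-- **THE PLUS-SYMBOL CONGRUENCE (C) FOR A REAL PRIME TWIST.** Let `W/ℚ` be globally minimal with good reduction at `2` and
`2 ∣ a₂(W)` (`GoodSS W 2`), `d > 0` a PRIME with `d ≡ 1 (mod 4)` and `(d, N_W) = 1`, `A` a globally minimal model of the
quadratic twist `W^{(d)}`, `f_W`, `f_A` the newforms, and assume some `[x]⁺_{f_A} ≠ 0` (e.g. `L(A,1) ≠ 0`). Grant modularity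
(`hmod`, to identify `f_A` with Shimura's `charTwist f_W`) and the period unit at `2` (`h2`, one of the crux's printed
inputs). THEN, with `a = a_d(W)` and `S = {1, d²}` (`a` even) resp. `{1, d, d²}` (`a` odd): for all `k ≥ 1`, `b` odd,
`2([b/4^k]⁺_{f_A} − [0]⁺_{f_A}) − ∑_{t∈S} 2([tb/4^k]⁺_{f_W} − [0]⁺_{f_W}) ∈ 2ℤ` — EXACTLY the hypothesis `hcong` of the
old-class descent `SignedMuAtTwo.exists_odd_of_plusSymbol_congruence` (rtt-p4-w2), here a THEOREM. Ingredients: Birch's lemma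
with its period constant (`exists_ratPlusSymbol_twist_eq_sum_and_sq`: `[x]⁺_{f_A} = c·∑_b (b/d)[x + b/d]⁺_{f_W}`,
`c²d(Ω⁺_{f_A})² = (Ω⁺_{f_W})²`), Pal's `√d·Ω(A) = Ω(W)` and `h2` at `W` and at `A` (so `|c|₂ = 1`, §1), and the mod-2 Hecke
sum `FlatTwist.exists_int_twistedSum_eq` (`(b/d) ≡ 𝟙_{b≠0}`). BSD is not proved by this.
[cite: MazurTateTeitelbaum1986Invent, §I.4 (4.2) and §I.8] [cite: Pal2012, Thm. 3.2 (case d > 0)] [cite: Shimura1971, Prop. 3.64] -/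
theorem exists_plusSymbol_congruence_twist (hmod : exists_isNewformOf)
    (h2 : Literature.NumberTheory.EllipticCurves.realPeriodRat_eq_unit_mul_plusPeriod_two)
    (hss : GoodSS W 2) (hd : 0 < d) (hd4 : d % 4 = 1) (hp : d.natAbs.Prime)
    (hcop : IsCoprime d (W.conductorNorm ℤ : ℤ)) {C : VariableChange ℚ} (hA : C • W.quadraticTwist (d : ℚ) = A)
    (hfW : IsNewformOf W fW) (hfA : IsNewformOf A fA) (hnz : ∃ x : ℚ, ratPlusSymbol fA x ≠ 0) :
    ∃ S : Finset ℕ, S.Nonempty ∧ (∀ t ∈ S, Odd t) ∧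
      ∀ k : ℕ, 1 ≤ k → ∀ b : ℤ, Odd b → ∃ z : ℤ,
        2 * (ratPlusSymbol fA ((b : ℚ) / 4 ^ k) - ratPlusSymbol fA 0) -
          ∑ t ∈ S, 2 * (ratPlusSymbol fW ((((t : ℤ) * b : ℤ) : ℚ) / 4 ^ k) - ratPlusSymbol fW 0) = 2 * z := by
  haveI : Fact (Nat.Prime 2) := ⟨Nat.prime_two⟩
  set m : ℕ := d.natAbs with hm_def
  haveI : NeZero m := ⟨hp.ne_zero⟩
  haveI : Fact m.Prime := ⟨hp⟩
  have hsq : Squarefree d := Int.squarefree_natAbs.mp hp.squarefree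
  have hmd : (m : ℤ) = d := Int.natAbs_of_nonneg hd.le
  have hmodd : Odd m := Int.natAbs_odd.mpr (Int.odd_iff.mpr (by omega))
  have hm3 : 3 ≤ m := by
    rcases hp.eq_two_or_odd' with h | h
    · exfalso; rw [h] at hmodd; exact (by decide : ¬ Odd 2) hmodd
    · have := hp.two_le; omega
  -- the Jacobi character and Birch's lemma with its period constant
  obtain ⟨χ, hχ⟩ := exists_mulChar_int_eq_jacobiSym m
  obtain ⟨c, hc, hcsq⟩ := exists_ratPlusSymbol_twist_eq_sum_and_sq W hmod hd hd4 hsq hcop hA hfW hfA hχ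
  -- reduction data: `A` good at `2` with `a₂(A) = (2/d)·a₂(W)`, `W` good at `m = d`
  have h2d : ¬ (2 : ℤ) ∣ d := by omega
  obtain ⟨hgoodA, haA⟩ := hasGoodReductionAtPrime_twist_and_frobeniusTrace_eq W 2 hmod hd4 hsq hcop hA hss.1 h2d
  have hssA : GoodSS A 2 := ⟨hgoodA, by rw [haA]; exact dvd_mul_of_dvd_right hss.2 _⟩
  have hmN : ¬ m ∣ W.conductorNorm ℤ := not_natAbs_dvd_conductorNorm W hp hcop
  have hgoodm : W.HasGoodReductionAtPrime m := by
    by_contra h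
    exact hmN ((W.dvd_conductorNorm_iff_not_hasGoodReductionAtPrime m).mpr h)
  set a : ℤ := W.frobeniusTrace m with ha_def
  have haW : cuspCoeff fW m = (a : ℂ) := cuspCoeff_eq_frobeniusTrace_of_isNewformOf_holds hfW hgoodm
  have h2NW : ¬ 2 ∣ W.conductorNorm ℤ := not_dvd_level_of_isNewformOf hfW hss.1
  have h2NA : ¬ 2 ∣ A.conductorNorm ℤ := not_dvd_level_of_isNewformOf hfA hgoodA
  have hrealW : ∀ n, (cuspCoeff fW n).im = 0 := cuspCoeff_im_eq_zero_of_coeffField_eq_bot hfW.coeffField_eq_bot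
  have hrealA : ∀ n, (cuspCoeff fA n).im = 0 := cuspCoeff_im_eq_zero_of_coeffField_eq_bot hfA.coeffField_eq_bot
  -- the period constant is a `2`-adic unit (Pal + `h2` at `W` and `A`)
  obtain ⟨uW, huW1, huW⟩ := h2 W hss.1 (P2.irr_two_of_goodSS_two W hss) fW hfW
  obtain ⟨uA, huA1, huA⟩ := h2 A hssA.1 (P2.irr_two_of_goodSS_two A hssA) fA hfA
  have hV : ∀ v : HeightOneSpectrum (𝓞 ℚ), ((primesEquiv v : ℕ) : ℤ) ∣ d →
      W.HasGoodReductionAt v ∨ W.HasMultiplicativeReductionAt v := by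
    intro v hvd
    left
    refine hasGoodReductionAt_of_not_dvd_conductorNorm W v fun hvN ↦ ?_
    have hℓ : ((primesEquiv v : ℕ)).Prime := (primesEquiv v).2
    have hu := Int.isUnit_iff_natAbs_eq.mp (hcop.isUnit_of_dvd' hvd (Int.natCast_dvd_natCast.mpr hvN))
    rw [Int.natAbs_natCast] at hu
    exact hℓ.one_lt.ne' hu
  have hPal := W.sqrt_mul_realPeriodRat_eq_of_twist_of_pos_of_squarefree hd hd4 hsq hV A C hA
  have hcu : ‖(c : ℚ_[2])‖ = 1 :=
    norm_birchConst_eq_one hd A.realPeriodRat_pos_holds (hcsq hnz) huW huA hPal huW1 huA1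
  -- the Legendre weight mod 2
  have hε : ∀ b : ZMod m, ∃ t : ℤ, χ b = (if b = 0 then 0 else 1) + 2 * t :=
    exists_jacobiWeight_eq_indicator_add hp hχ
  -- the dilation set
  refine ⟨if Even a then ({1, m ^ 2} : Finset ℕ) else {1, m, m ^ 2}, ?_, ?_, ?_⟩
  · split_ifs <;> simp
  · intro t ht
    have hm2 : Odd (m ^ 2) := hmodd.pow
    split_ifs at ht
    · simp only [Finset.mem_insert, Finset.mem_singleton] at ht
      rcases ht with rfl | rfl
      · exact odd_one
      · exact hm2
    · simp only [Finset.mem_insert, Finset.mem_singleton] at ht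
      rcases ht with rfl | rfl | rfl
      · exact odd_one
      · exact hmodd
      · exact hm2
  intro k hk b hb
  set x : ℚ := (b : ℚ) / 4 ^ k with hx_def
  have h4pow : ((4 : ℚ) ^ k) = 2 ^ (2 * k) := by rw [pow_mul]; norm_num
  have hxW : x.den.Coprime (W.conductorNorm ℤ) := by
    rw [hx_def, h4pow]; exact SignedMuAtTwo.coprime_den_div_two_pow h2NW b (2 * k)
  have hxA : x.den.Coprime (A.conductorNorm ℤ) := by
    rw [hx_def, h4pow]; exact SignedMuAtTwo.coprime_den_div_two_pow h2NA b (2 * k)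
  -- the twisted Hecke sum of `f_W` at `x` modulo `2ℤ`
  obtain ⟨z₁, hz₁⟩ := exists_int_twistedSum_eq fW hfW.1 hfW.coeffField_eq_bot hp hmN haW (fun b ↦ χ b) hε hxW
  -- integers: `M_A(x)`, `I_W(x)`, `I_W(mx)`, `I_W(m²x)`
  obtain ⟨mA, hmA⟩ := SignedMuAtTwo.exists_two_mul_ratPlusSymbol_sub_eq_intCast fA hrealA hxA
  obtain ⟨i0, hi0⟩ := SignedMuAtTwo.exists_two_mul_ratPlusSymbol_sub_eq_intCast fW hrealW hxW
  obtain ⟨v, hv⟩ := SignedMuAtTwo.exists_two_mul_ratPlusSymbol_sub_eq_intCast fW hrealW (coprime_den_natCast_mul hxW m)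
  obtain ⟨w, hw⟩ := SignedMuAtTwo.exists_two_mul_ratPlusSymbol_sub_eq_intCast fW hrealW
    (coprime_den_natCast_mul hxW (m ^ 2))
  have hpw : ((m ^ 2 : ℕ) : ℚ) * x = (m : ℚ) ^ 2 * x := by push_cast; ring
  rw [hpw] at hw
  -- Birch at `x` and at `0`: `M_A(x) = c · (twisted sum)`
  have hχcast : ∀ b : ZMod m, ((χ.ringHomComp (Int.castRingHom ℚ)) b : ℚ) = ((χ b : ℤ) : ℚ) := fun b ↦ by
    rw [MulChar.ringHomComp_apply]; rfl
  have hMA : (mA : ℚ) = c * ((i0 : ℚ) + a * v + w + 2 * z₁) := by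
    have hx1 := hc x
    have hx0 := hc 0
    simp only [zero_add] at hx0
    rw [← hmA, hx1, hx0, ← hi0, ← hv, ← hw]
    have h2 : 2 * (c * ∑ b : ZMod m, (χ.ringHomComp (Int.castRingHom ℚ)) b * ratPlusSymbol fW (x + (b.val : ℚ) / m) -
        c * ∑ b : ZMod m, (χ.ringHomComp (Int.castRingHom ℚ)) b * ratPlusSymbol fW ((b.val : ℚ) / m)) =
        c * ∑ b : ZMod m, ((χ b : ℤ) : ℚ) *
          (2 * ratPlusSymbol fW (x + (b.val : ℚ) / m) - 2 * ratPlusSymbol fW ((b.val : ℚ) / m)) := by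
      calc _ = c * (2 * (∑ b : ZMod m, (χ.ringHomComp (Int.castRingHom ℚ)) b * ratPlusSymbol fW (x + (b.val : ℚ) / m) -
            ∑ b : ZMod m, (χ.ringHomComp (Int.castRingHom ℚ)) b * ratPlusSymbol fW ((b.val : ℚ) / m))) := by ring
        _ = _ := by
          congr 1
          rw [← Finset.sum_sub_distrib, Finset.mul_sum]
          refine Finset.sum_congr rfl fun b _ ↦ ?_
          rw [hχcast]
          ring
    rw [h2, hz₁]
  -- hence `M_A(x) ≡ I_W(x) + a·I_W(mx) + I_W(m²x) (mod 2)`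
  obtain ⟨z₂, hz₂⟩ := exists_sub_eq_two_mul_of_eq_unit_mul (J := i0 + a * v + w + 2 * z₁) hcu (by rw [hMA]; push_cast; ring)
  -- the two dilation sets
  have hm1 : (1 : ℕ) ≠ m ^ 2 := by nlinarith
  have hm1' : (1 : ℕ) ≠ m := by omega
  have hmm : m ≠ m ^ 2 := by nlinarith
  have ht1 : ratPlusSymbol fW (((((1 : ℕ) : ℤ) * b : ℤ) : ℚ) / 4 ^ k) = ratPlusSymbol fW x := by
    rw [hx_def]; push_cast; ring_nf
  have htm : ratPlusSymbol fW (((((m : ℕ) : ℤ) * b : ℤ) : ℚ) / 4 ^ k) = ratPlusSymbol fW ((m : ℚ) * x) := by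
    rw [hx_def]; push_cast; ring_nf
  have htm2 : ratPlusSymbol fW (((((m ^ 2 : ℕ) : ℤ) * b : ℤ) : ℚ) / 4 ^ k) = ratPlusSymbol fW ((m : ℚ) ^ 2 * x) := by
    rw [hx_def]; push_cast; ring_nf
  by_cases hae : Even a
  · rw [if_pos hae]
    obtain ⟨r, hr⟩ := hae
    refine ⟨z₂ + r * v + z₁, ?_⟩
    rw [Finset.sum_pair hm1, ht1, htm2, hmA, hi0, hw]
    have hz₂' : (mA : ℚ) - (i0 + a * v + w + 2 * z₁) = 2 * z₂ := by exact_mod_cast hz₂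
    have hr' : (a : ℚ) = r + r := by exact_mod_cast hr
    push_cast
    linear_combination hz₂' + (v : ℚ) * hr'
  · rw [if_neg hae]
    have hao : Odd a := Int.not_even_iff_odd.mp hae
    obtain ⟨r, hr⟩ := hao
    refine ⟨z₂ + r * v + z₁, ?_⟩
    rw [Finset.sum_insert (by simp [hm1', hm1]), Finset.sum_pair hmm, ht1, htm, htm2, hmA, hi0, hv, hw]
    have hz₂' : (mA : ℚ) - (i0 + a * v + w + 2 * z₁) = 2 * z₂ := by exact_mod_cast hz₂
    have hr' : (a : ℚ) = 2 * r + 1 := by exact_mod_cast hr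
    push_cast
    linear_combination hz₂' + (v : ℚ) * hr'

end Congruence

end FlatTwist

end Summit.BirchSwinnertonDyer.BirchSwinnertonDyer.Theorems

end
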